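import Summits.KontsevichZagierPeriods.KontsevichZagierPeriods.Theorems.TerasomaMultiplicationTriplicationFromMultiplicationDirichlet
import Summits.KontsevichZagierPeriods.KontsevichZagierPeriods.Theorems.TerasomaMultiplicationTriplicationFromMultiplicationAlgebra
import Summits.KontsevichZagierPeriods.KontsevichZagierPeriods.Theorems.MultiplicationThree.Negative.BoxToBox
import Summits.KontsevichZagierPeriods.KontsevichZagierPeriods.Theorems.GammaHodgeSector.Negative.Calibration
import Literature.NumberTheory.Transcendental.GammaMonomialsProofs

/-!
# `TriplicationFromMultiplication` (stmt-KontsevichZagierPeriods-13693) — part 4: bridges to the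
three antecedents and to the target pair

Helper file for the cancellation glue of route TerasomaMultiplication. It rewrites the pinned data
of the antecedents `MultiplicationThree` (at `s = 1/9`, in the box-to-box form of
`MultiplicationThreeNegative.multiplicationThree_iff_boxToBox`), `ReflectionThird` and
`BetaCancellation` (kernel form `BetaCancellationNegative.betaCancellation_iff`) as statements about
products of the Beta representations `β(a,b) = KZ.IntegralRep.ofMellin (X₀, 1−X₀) (a−1, b−1) 1`, and
supplies the two remaining explicit moves of the derivation: the Kummer dilation `t ↦ t³`
(`[(0,1), 3] ∼ [β(1/3,1)]`, `KZ.of_sub_of_mem_relations_of_boxDilation`) and the scaling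
`z ↦ 2z` of the unit disc onto the disc of radius `2`.
-/

noncomputable section

open MeasureTheory Set
open scoped BigOperators

namespace Summit.KontsevichZagierPeriods.TerasomaMultiplication.TriplicationGlue

open Literature.NumberTheory.Transcendental
open Literature.NumberTheory.Transcendental.KZ
open Literature.ModelTheory.ExponentialFields (IsSemialgebraic)
open MvPolynomial (aeval X C)
open Summit.KontsevichZagierPeriods.KontsevichZagierPeriods.BetaCancellationNegative
  (betaKernel polyKernelRep IsPinned KernelCancellation betaCancellation_iff isPinned_prod mem_unitIoo)
open Literature.NumberTheory.Transcendental.KZreg (unitIoo)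
open Summit.KontsevichZagierPeriods.KontsevichZagierPeriods.Theses.TerasomaMultiplication
  (MultiplicationThree ReflectionThird BetaCancellation)
open Summit.KontsevichZagierPeriods.GammaHodgeSectorNegative (discRep unitDisc isSemialgebraic_unitDisc
  equivalent_piRep_discRep)

/-- The Beta family `(X₀, 1 − X₀)` on `ℝ¹` (local notation `bF`). -/
local notation "bF" => (![MvPolynomial.X 0, 1 - MvPolynomial.X 0] : Fin 2 → MvPolynomial (Fin 1) ℚ)

/-- The Beta representation `β(a,b)` (local notation; `h` is the convergence proof). -/
local notation "𝛃(" a ", " b ", " h ")" =>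
  IntegralRep.ofMellin (![MvPolynomial.X 0, 1 - MvPolynomial.X 0] : Fin 2 → MvPolynomial (Fin 1) ℚ)
    ![a - 1, b - 1] 1 h

/-! ## The Kummer dilation `t ↦ t³`: `[(0,1), 3] ∼ [β(1/3, 1)]` -/

/-- **`[(0,1), 3] ∼ [β(1/3,1)] = [(0,1), t^{-2/3}]`**: ONE change of variables `t ↦ t³`
(`KZ.boxDilation 0 2`, Jacobian `3t²`; `(t³)^{-2/3}·3t² = 3`). [cite: KontsevichZagier2001, §1.2 rule (2)] -/
theorem unit_three_equiv_beta_third_one (h3 : IsAlgebraic ℚ (3:ℝ))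
    (h : IntegrableOn (mellinIntegrand bF ![1 / 3 - 1, 1 - 1] 1) (mellinBox bF) volume) :
    Equivalent ((polyKernelRep 1).constMul 3 h3) (𝛃(1 / 3, 1, h)) := by
  refine of_sub_of_mem_relations_of_boxDilation (0 : Fin 1) 2 (fun x hx => ?_) ?_ fun x hx => ?_
  · exact ((mem_unitIoo x).1 hx).1
  · rw [IntegralRep.ofMellin_domain]
    ext y
    rw [mem_mellinBox_bF, IntegralRep.domain_constMul, Summit.KontsevichZagierPeriods.KontsevichZagierPeriods.BetaCancellationNegative.polyKernelRep_domain]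
    constructor
    · rintro ⟨hy0, hy1⟩
      refine ⟨fun _ => y 0 ^ ((3:ℕ):ℝ)⁻¹, (mem_unitIoo _).2 ⟨Real.rpow_pos_of_pos hy0 _,
        Real.rpow_lt_one hy0.le hy1 (by positivity)⟩, ?_⟩
      funext i
      rw [Subsingleton.elim i 0, boxDilation_apply_self]
      exact Real.rpow_inv_natCast_pow hy0.le three_ne_zero
    · rintro ⟨x, hx, rfl⟩
      rw [boxDilation_apply_self]
      obtain ⟨hx0, hx1⟩ := (mem_unitIoo x).1 hx
      exact ⟨pow_pos hx0 3, pow_lt_one₀ hx0.le hx1 three_ne_zero⟩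
  · obtain ⟨hx0, -⟩ := (mem_unitIoo x).1 hx
    rw [IntegralRep.integrand_constMul, IntegralRep.ofMellin_integrand, mellinIntegrand_bF,
      Summit.KontsevichZagierPeriods.KontsevichZagierPeriods.BetaCancellationNegative.polyKernelRep_integrand,
      boxDilation_apply_self]
    simp only [map_one, mul_one, betaKernel]
    have e1 : (((1 / 3 : ℚ) : ℝ) - 1) = -2 * ((3:ℕ):ℝ)⁻¹ := by push_cast; norm_num
    have e2 : (((1 : ℚ) : ℝ) - 1) = 0 := by push_cast; ring
    rw [e1, e2, Real.rpow_zero, mul_one, ← Real.rpow_natCast (x 0) 3, ← Real.rpow_mul hx0.le,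
      mul_comm ((3:ℕ):ℝ) _, mul_assoc, inv_mul_cancel₀ (by positivity), mul_one,
      Real.rpow_neg hx0.le, Real.rpow_two]
    push_cast
    field_simp

/-! ## `MultiplicationThree` at `s = 1/9` as a statement about Beta products -/

/-- The box representation of the crux at `s = 1/9` is `[β(1/3,1/9)] × [β(2/3,1/9)]` up to the
spelling of its integrand (congruence on the domain). [folklore] -/
theorem boxRep_ninth_equiv (hs : 0 < (1 / 9 : ℚ))
    (h₁ : IntegrableOn (mellinIntegrand bF ![1 / 3 - 1, 1 / 9 - 1] 1) (mellinBox bF) volume)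
    (h₂ : IntegrableOn (mellinIntegrand bF ![2 / 3 - 1, 1 / 9 - 1] 1) (mellinBox bF) volume) :
    Equivalent (MultiplicationThreeNegative.boxRep (1 / 9) hs) ((𝛃(1 / 3, 1 / 9, h₁)).prod (𝛃(2 / 3, 1 / 9, h₂))) := by
  refine of_sub_of_mem_relations_of_eqOn ?_ fun x hx => ?_
  · rw [prod_beta_domain]
    ext x
    change _ ↔ x ∈ MultiplicationThreeNegative.box
    simp only [MultiplicationThreeNegative.box, mem_setOf_eq, Fin.forall_fin_two]
  · rw [prod_beta_integrand]
    change MultiplicationThreeNegative.boxFun (1 / 9) x = _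
    simp only [MultiplicationThreeNegative.boxFun, betaKernel]
    have e1 : (((1 / 3 : ℚ) : ℝ) - 1) = -(2:ℝ) / 3 := by push_cast; norm_num
    have e2 : (((2 / 3 : ℚ) : ℝ) - 1) = -(1:ℝ) / 3 := by push_cast; norm_num
    rw [e1, e2]
    ring

/-- `9 · 27^{1/9 − 1}` is algebraic. [folklore] -/
theorem isAlgebraic_pullConst_ninth : IsAlgebraic ℚ (MultiplicationThreeNegative.pullConst (1 / 9)) := by
  unfold MultiplicationThreeNegative.pullConst
  refine (isAlgebraic_nat 9).mul ?_
  have h := KoblitzOgus.isAlgebraic_nat_rpow_rat (m := 27) (by norm_num) (-8) (q := 9) (by norm_num)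
  have e : (27:ℝ) ^ (((1 / 9 : ℚ) : ℝ) - 1) = ((27:ℕ):ℝ) ^ (((-8:ℤ):ℝ) / ((9:ℕ):ℝ)) := by
    push_cast
    norm_num
  rw [e]
  exact h

/-- `9 · 27^{1/9 − 1} ≠ 0`. [folklore] -/
theorem pullConst_ninth_ne_zero : MultiplicationThreeNegative.pullConst (1 / 9) ≠ 0 := by
  unfold MultiplicationThreeNegative.pullConst
  positivity

/-- The pulled-back representation of the crux at `s = 1/9` is `9·27^{-8/9} · [β(1/9,2/9)] × [β(1/9,1/9)]`
up to the spelling of its integrand (`MultiplicationThreeNegative.pullbackFun_eq_prod`). [folklore] -/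
theorem pullbackRep_ninth_equiv (hs : 0 < (1 / 9 : ℚ))
    (h₁ : IntegrableOn (mellinIntegrand bF ![1 / 9 - 1, 2 / 9 - 1] 1) (mellinBox bF) volume)
    (h₂ : IntegrableOn (mellinIntegrand bF ![1 / 9 - 1, 1 / 9 - 1] 1) (mellinBox bF) volume)
    (hc : IsAlgebraic ℚ (MultiplicationThreeNegative.pullConst (1 / 9))) :
    Equivalent (MultiplicationThreeNegative.pullbackRep (1 / 9) hs)
      (((𝛃(1 / 9, 2 / 9, h₁)).prod (𝛃(1 / 9, 1 / 9, h₂))).constMul _ hc) := by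
  refine of_sub_of_mem_relations_of_eqOn ?_ fun x hx => ?_
  · rw [IntegralRep.domain_constMul, prod_beta_domain]
    ext x
    change _ ↔ x ∈ MultiplicationThreeNegative.box
    simp only [MultiplicationThreeNegative.box, mem_setOf_eq, Fin.forall_fin_two]
  · rw [IntegralRep.integrand_constMul]
    dsimp only
    rw [prod_beta_integrand]
    change MultiplicationThreeNegative.pullbackFun (1 / 9) x = _
    rw [MultiplicationThreeNegative.pullbackFun_eq_prod hx]
    simp only [MultiplicationThreeNegative.pullFactor, Fin.prod_univ_two, Matrix.cons_val_zero,
      Matrix.cons_val_one, betaKernel]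
    have e1 : (((2 / 9 : ℚ) : ℝ) - 1) = 2 * ((1 / 9 : ℚ) : ℝ) - 1 := by push_cast; ring
    rw [e1]

/-- **`MultiplicationThree` at `s = 1/9`, Beta form**:
`[β(1/3,1/9)] × [β(2/3,1/9)] ∼ 9·27^{-8/9} · [β(1/9,2/9)] × [β(1/9,1/9)]`
(`B(1/3,1/9)B(2/3,1/9) = 3^{-2/3} B(1/9,2/9)B(1/9,1/9)`). [folklore] -/
theorem multiplicationThree_ninth (hM : MultiplicationThree)
    (h₁ : IntegrableOn (mellinIntegrand bF ![1 / 3 - 1, 1 / 9 - 1] 1) (mellinBox bF) volume)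
    (h₂ : IntegrableOn (mellinIntegrand bF ![2 / 3 - 1, 1 / 9 - 1] 1) (mellinBox bF) volume)
    (h₃ : IntegrableOn (mellinIntegrand bF ![1 / 9 - 1, 2 / 9 - 1] 1) (mellinBox bF) volume)
    (h₄ : IntegrableOn (mellinIntegrand bF ![1 / 9 - 1, 1 / 9 - 1] 1) (mellinBox bF) volume)
    (hc : IsAlgebraic ℚ (MultiplicationThreeNegative.pullConst (1 / 9))) :
    Equivalent ((𝛃(1 / 3, 1 / 9, h₁)).prod (𝛃(2 / 3, 1 / 9, h₂)))
      (((𝛃(1 / 9, 2 / 9, h₃)).prod (𝛃(1 / 9, 1 / 9, h₄))).constMul _ hc) := by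
  have hs : 0 < (1 / 9 : ℚ) := by norm_num
  exact ((boxRep_ninth_equiv hs h₁ h₂).symm.trans
    (MultiplicationThreeNegative.multiplicationThree_iff_boxToBox.1 hM (1 / 9) hs)).trans
    (pullbackRep_ninth_equiv hs h₃ h₄ hc)

/-! ## `ReflectionThird` as a statement about `β(1/3, 2/3)` -/

/-- `sin(π/3)` is algebraic (`= √3/2`). [folklore] -/
theorem isAlgebraic_sin_pi_div_three : IsAlgebraic ℚ (Real.sin (Real.pi / 3)) := by
  have h := KoblitzOgus.isAlgebraic_sin_rat_mul_pi 1 (b := 3) (by norm_num)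
  simpa using h

/-- `sin(π/3) ≠ 0`. [folklore] -/
theorem sin_pi_div_three_ne_zero : Real.sin (Real.pi / 3) ≠ 0 := by
  rw [Real.sin_pi_div_three]
  positivity

/-- **`ReflectionThird`, Beta form**: `sin(π/3) · [β(1/3,2/3)] ∼ [π]` (`= KZ.piRep`, the closed unit
disc). [folklore] -/
theorem reflectionThird_beta (hR : ReflectionThird) (hs : IsAlgebraic ℚ (Real.sin (Real.pi / 3)))
    (h : IntegrableOn (mellinIntegrand bF ![1 / 3 - 1, 2 / 3 - 1] 1) (mellinBox bF) volume) :
    Equivalent ((𝛃(1 / 3, 2 / 3, h)).constMul _ hs) piRep := by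
  refine hR _ piRep ?_ (fun x _ => ?_) rfl fun _ _ => rfl
  · rw [IntegralRep.domain_constMul, IntegralRep.ofMellin_domain, mellinBox_bF_eq_setOf]
  · rw [IntegralRep.integrand_constMul]
    dsimp only
    rw [IntegralRep.ofMellin_integrand, mellinIntegrand_bF]
    simp only [betaKernel]
    have e1 : (((1 / 3 : ℚ) : ℝ) - 1) = -(2:ℝ) / 3 := by push_cast; norm_num
    have e2 : (((2 / 3 : ℚ) : ℝ) - 1) = -(1:ℝ) / 3 := by push_cast; norm_num
    rw [e1, e2, mul_assoc]

/-! ## `BetaCancellation` as cancellation of a Beta factor -/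

/-- **`BetaCancellation`, Beta form**: `[β(a,b)] × r ∼ [β(a,b)] × r' → r ∼ r'` for `0 < a, b`.
[folklore] -/
theorem beta_cancel (hB : BetaCancellation) {a b : ℚ} (ha : 0 < a) (hb : 0 < b)
    (h : IntegrableOn (mellinIntegrand bF ![a - 1, b - 1] 1) (mellinBox bF) volume)
    {n m : ℕ} {r : IntegralRep n} {r' : IntegralRep m}
    (hq : Equivalent ((𝛃(a, b, h)).prod r) ((𝛃(a, b, h)).prod r')) : Equivalent r r' :=
  betaCancellation_iff.1 hB a b ha hb r r' _ _
    (isPinned_prod _ mellinBox_bF_eq (fun x _ => mellinIntegrand_bF a b x) r)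
    (isPinned_prod _ mellinBox_bF_eq (fun x _ => mellinIntegrand_bF a b x) r') hq

/-! ## The target pair: `c · [π] ∼ [disc of radius 2, c/4]` -/

/-- **Scaling move**: `c·[open unit disc, 1] ∼ [disc of radius 2, c/4]` for the target spelling
`c/4 = 3^{7/6}/2`, `c = 2·3^{7/6}`: one change of variables `z ↦ 2z`, `|det| = 4` (rule 2).
Adapted from the disprover's `equivalent_constDisc_radiusTwo` (Cruxes/GammaHodgeSector/Disproof.lean §7).
[cite: KontsevichZagier2001, §1.2 rule (2)] -/
theorem constDisc_equiv_radiusTwo (hκ : IsAlgebraic ℚ (2 * (3:ℝ) ^ ((7:ℝ) / 6))) (r' : IntegralRep 2)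
    (hd' : r'.domain = {x | x 0 ^ 2 + x 1 ^ 2 < 4})
    (hi' : EqOn r'.integrand (fun _ => (3:ℝ) ^ ((7:ℝ) / 6) / 2) r'.domain) :
    Equivalent (discRep.constMul _ hκ) r' := by
  set R := discRep.constMul _ hκ with hR
  set Φ : (Fin 2 → ℝ) → (Fin 2 → ℝ) := fun x => (2 : ℝ) • x with hΦ
  set Φ' : (Fin 2 → ℝ) → (Fin 2 → ℝ) →L[ℝ] (Fin 2 → ℝ) :=
    fun _ => (2 : ℝ) • ContinuousLinearMap.id ℝ (Fin 2 → ℝ) with hΦ'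
  have hdomR : R.domain = unitDisc := rfl
  have himage : r'.domain = Φ '' R.domain := by
    rw [hd', hdomR]
    ext y
    simp only [mem_setOf_eq, mem_image, unitDisc, hΦ]
    constructor
    · intro hy
      refine ⟨(1 / 2 : ℝ) • y, ?_, ?_⟩
      · simp only [Pi.smul_apply, smul_eq_mul]
        nlinarith
      · ext j
        simp
    · rintro ⟨x, hx, rfl⟩
      simp only [Pi.smul_apply, smul_eq_mul]
      nlinarith
  have hdet : ∀ x, |(Φ' x).det| = 4 := by
    intro x
    simp only [hΦ', ContinuousLinearMap.det, ContinuousLinearMap.toLinearMap_smul, ContinuousLinearMap.coe_id,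
      LinearMap.det_smul, LinearMap.det_id, Module.finrank_fin_fun, mul_one]
    norm_num
  refine changeOfVariablesRel_subset_relations ⟨2, R, r', Φ, Φ', ?_, ?_, ?_, himage, ?_, rfl⟩
  · refine (isSemialgebraicMapOn_aeval isSemialgebraic_unitDisc
      (fun j => 2 * MvPolynomial.X j : Fin 2 → MvPolynomial (Fin 2) ℚ)).congr fun x _ => ?_
    ext j
    simp [hΦ]
  · intro x _
    have h := ((hasFDerivAt_id (𝕜 := ℝ) x).const_smul (2 : ℝ)).hasFDerivWithinAt (s := R.domain)
    simpa [hΦ, hΦ'] using h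
  · intro a _ b _ hab
    exact smul_right_injective (Fin 2 → ℝ) (two_ne_zero (α := ℝ)) hab
  · intro x hx
    have hΦx : Φ x ∈ r'.domain := by rw [himage]; exact mem_image_of_mem Φ hx
    rw [hi' hΦx, hdet x, hR, IntegralRep.integrand_constMul]
    change 2 * (3:ℝ) ^ ((7:ℝ) / 6) * 1 = _
    ring

/-- **The target pair from `[π]`**: `2·3^{7/6}·[π] ∼ [disc of radius 2, 3^{7/6}/2]`
(`[π] ∼ [open unit disc, 1]` along the null unit circle, then the scaling move). [folklore] -/
theorem piRep_const_equiv_target (hκ : IsAlgebraic ℚ (2 * (3:ℝ) ^ ((7:ℝ) / 6))) (r' : IntegralRep 2)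
    (hd' : r'.domain = {x | x 0 ^ 2 + x 1 ^ 2 < 4})
    (hi' : EqOn r'.integrand (fun _ => (3:ℝ) ^ ((7:ℝ) / 6) / 2) r'.domain) :
    Equivalent (piRep.constMul _ hκ) r' :=
  (equivalent_piRep_discRep.constMul _ hκ).trans (constDisc_equiv_radiusTwo hκ r' hd' hi')

end Summit.KontsevichZagierPeriods.TerasomaMultiplication.TriplicationGlue
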